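import Summits.Ventures.HodgeRepro.SingleClass
import Summits.Ventures.HodgeRepro.Induced
import Summits.Ventures.HodgeRepro.CyclicRecipe

/-!
# Pulling a single-class quadruple back along a surjection `G → G'`

Blind re-derivation cell `pub-hodge-repro`, seat `p1` (gen 9).  A surjective homomorphism `π : G →* G'` with
`π c = c'` is the typer's model of a Galois CM SUBFIELD (`G' = Gal(K'/ℚ)` for `K' ⊆ K`, `c'` its complex conjugation).
A single-class `SumTwo` quadruple without a conjugate pair on `(G', c')` — base type `Φ`, twists `g i` — pulls back to
one on `(G, c)`: the induced type `Φ' = π⁻¹(Φ)` (`preimageSet`) with any lifts `g' i` of the twists.  Everything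
transports except primitivity (`Φ'` is induced from `K'`, so `A_{Φ'}` is isogenous to a power of `A_Φ`): the CM
condition, `SumTwo`, the absence of a conjugate pair, single-class-ness, Pohlmann's condition and the non-stability of
the `4`-set (`IsExceptional`), and «a coset of no subgroup» (a coset upstairs would map to a coset downstairs).

With `CyclicRecipe.lean`: EVERY Galois CM field whose Galois group surjects onto a cyclic group of order `2m`,
`m = r p q` (`r ≥ 2`, `p ≠ q` odd primes), with `c ↦ m` — i.e. every Galois CM field with a cyclic CM subfield of such a
degree — carries a single-class `SumTwo` quadruple of CM types without a conjugate pair whose Pohlmann `4`-set is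
exceptional and a coset of no subgroup (`exists_quad_of_surjective_cyclic`).
-/

set_option autoImplicit false

open Finset
open scoped Pointwise

namespace HodgeRepro.QuadPullback

variable {G G' : Type*} [Group G] [Group G'] [Fintype G] [DecidableEq G] [DecidableEq G']

omit [DecidableEq G] in
/-- The pull-back of a CM type along `π` with `π c = c'` is a CM type. -/
theorem isCMType_preimageSet (π : G →* G') {c : G} {c' : G'} (hc : π c = c') {Φ : Finset G'}
    (hΦ : IsCMType c' Φ) : IsCMType c (preimageSet π Φ) := by
  intro x
  rw [mem_preimageSet, mem_preimageSet, map_mul, hc]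
  exact hΦ (π x)

omit [DecidableEq G] in
/-- Membership in a twist of the pull-back: `x ∈ π⁻¹(Φ) · g' ↔ π x ∈ Φ · π g'`. -/
theorem mem_rmul_preimageSet (π : G →* G') (Φ : Finset G') (g' : G) (x : G) :
    x ∈ rmul (preimageSet π Φ) g' ↔ π x ∈ rmul Φ (π g') := by
  rw [mem_rmul, mem_rmul, mem_preimageSet, map_mul, map_inv]

/-- `SumTwo` pulls back. -/
theorem sumTwo_preimageSet (π : G →* G') (Φ : Finset G') (g : Fin 4 → G') (g' : Fin 4 → G)
    (hg : ∀ i, π (g' i) = g i) (hs : SumTwo (fun i => rmul Φ (g i))) :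
    SumTwo (fun i => rmul (preimageSet π Φ) (g' i)) := by
  intro x
  have := hs (π x)
  rw [← this]
  congr 1
  apply Finset.filter_congr
  intro i _
  rw [mem_rmul_preimageSet, hg]

/-- No conjugate pair pulls back (surjectivity). -/
theorem noConjugatePair_preimageSet (π : G →* G') (hπ : Function.Surjective π) {c : G} {c' : G'} (hc : π c = c')
    (Φ : Finset G') (g : Fin 4 → G') (g' : Fin 4 → G) (hg : ∀ i, π (g' i) = g i)
    (hnc : ∀ i j : Fin 4, rmul Φ (g j) ≠ c' • rmul Φ (g i)) :
    ∀ i j : Fin 4, rmul (preimageSet π Φ) (g' j) ≠ c • rmul (preimageSet π Φ) (g' i) := by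
  intro i j heq
  apply hnc i j
  ext y
  obtain ⟨x, rfl⟩ := hπ y
  rw [← hg j, ← mem_rmul_preimageSet, heq, ← Finset.inv_smul_mem_iff, smul_eq_mul, mem_rmul_preimageSet,
    map_mul, map_inv, hc, hg, ← smul_eq_mul, Finset.inv_smul_mem_iff]

omit [DecidableEq G] in
/-- The pull-back quadruple is single-class. -/
theorem isSingleClass_preimageSet (π : G →* G') (Φ : Finset G') (g' : Fin 4 → G) :
    IsSingleClass (fun i => rmul (preimageSet π Φ) (g' i)) := by
  intro i
  refine ⟨(g' 0)⁻¹ * g' i, ?_⟩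
  simp only [rmul_rmul, mul_inv_cancel_left]

omit [Fintype G] in
/-- The image of the pulled-back twist set is the twist set. -/
theorem image_twistSet (π : G →* G') (g : Fin 4 → G') (g' : Fin 4 → G) (hg : ∀ i, π (g' i) = g i) :
    (twistSet g' 1).image π = twistSet g 1 := by
  ext y
  simp only [twistSet, mem_image, mem_univ, true_and, one_mul]
  constructor
  · rintro ⟨x, ⟨i, rfl⟩, rfl⟩; exact ⟨i, by rw [map_inv, hg]⟩
  · rintro ⟨i, rfl⟩; exact ⟨(g' i)⁻¹, ⟨i, rfl⟩, by rw [map_inv, hg]⟩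

omit [Fintype G] in
/-- The image of `c • S` is `π c • image`. -/
theorem image_smul_finset (π : G →* G') (c : G) (S : Finset G) : (c • S).image π = π c • S.image π := by
  ext y
  simp only [mem_image, Finset.mem_smul_finset, smul_eq_mul]
  constructor
  · rintro ⟨x, ⟨s, hs, rfl⟩, rfl⟩; exact ⟨π s, ⟨s, hs, rfl⟩, by rw [map_mul]⟩
  · rintro ⟨t, ⟨s, hs, rfl⟩, rfl⟩; exact ⟨c * s, ⟨s, hs, rfl⟩, by rw [map_mul]⟩

/-- `IsExceptional` pulls back (Pohlmann's condition from the pulled-back `SumTwo`, non-stability by the image). -/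
theorem isExceptional_preimageSet (π : G →* G') {c : G} {c' : G'} (hc : π c = c') (hcc : IsComplexConj c)
    (Φ : Finset G') (g : Fin 4 → G') (g' : Fin 4 → G) (hg : ∀ i, π (g' i) = g i) (hinj : Function.Injective g)
    (hs : SumTwo (fun i => rmul Φ (g i))) (hex : IsExceptional c' Φ (twistSet g 1)) :
    IsExceptional c (preimageSet π Φ) (twistSet g' 1) := by
  have hinj' : Function.Injective g' := fun i j h => hinj (by rw [← hg, ← hg, h])
  refine ⟨isHodgeSet_twistSet hcc (preimageSet π Φ) g' hinj' (sumTwo_preimageSet π Φ g g' hg hs) 1, ?_⟩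
  intro h
  apply hex.2
  have := congrArg (fun S => S.image π) h
  simpa only [image_smul_finset, image_twistSet π g g' hg, hc] using this

omit [Fintype G] in
/-- «A coset of no subgroup» pulls back: a coset `H h` upstairs maps onto the coset `π(H) π(h)` downstairs. -/
theorem not_coset_preimageSet (π : G →* G') (g : Fin 4 → G') (g' : Fin 4 → G) (hg : ∀ i, π (g' i) = g i)
    (hnc : ¬ ∃ (H : Subgroup G') (h : G'), ∀ y, y ∈ twistSet g 1 ↔ ∃ k ∈ H, y = k * h) :
    ¬ ∃ (H : Subgroup G) (h : G), ∀ x, x ∈ twistSet g' 1 ↔ ∃ k ∈ H, x = k * h := by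
  rintro ⟨H, h, hH⟩
  apply hnc
  refine ⟨H.map π, π h, fun y => ?_⟩
  rw [← image_twistSet π g g' hg, mem_image]
  constructor
  · rintro ⟨x, hx, rfl⟩
    obtain ⟨k, hk, rfl⟩ := (hH x).mp hx
    exact ⟨π k, Subgroup.mem_map_of_mem π hk, by rw [map_mul]⟩
  · rintro ⟨k', hk', rfl⟩
    obtain ⟨k, hk, rfl⟩ := Subgroup.mem_map.mp hk'
    exact ⟨k * h, (hH _).mpr ⟨k, hk, rfl⟩, by rw [map_mul]⟩

/-- **Pull-back of a full instance** along a surjection with `π c = c'`: everything except primitivity. -/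
theorem exists_quad_of_surjective (π : G →* G') (hπ : Function.Surjective π) {c : G} {c' : G'} (hc : π c = c')
    (hcc : IsComplexConj c) (Φ : Finset G') (g : Fin 4 → G') (hinj : Function.Injective g)
    (hΦ : IsCMType c' Φ) (hs : SumTwo (fun i => rmul Φ (g i)))
    (hnc : ∀ i j : Fin 4, rmul Φ (g j) ≠ c' • rmul Φ (g i))
    (hex : IsExceptional c' Φ (twistSet g 1))
    (hcos : ¬ ∃ (H : Subgroup G') (h : G'), ∀ y, y ∈ twistSet g 1 ↔ ∃ k ∈ H, y = k * h) :
    ∃ (Φ' : Finset G) (g' : Fin 4 → G),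
      IsCMType c Φ' ∧ SumTwo (fun i => rmul Φ' (g' i)) ∧
      (∀ i j : Fin 4, rmul Φ' (g' j) ≠ c • rmul Φ' (g' i)) ∧ IsSingleClass (fun i => rmul Φ' (g' i)) ∧
      IsExceptional c Φ' (twistSet g' 1) ∧
      ¬ ∃ (H : Subgroup G) (h : G), ∀ x, x ∈ twistSet g' 1 ↔ ∃ k ∈ H, x = k * h := by
  choose g' hg using fun i => hπ (g i)
  exact ⟨preimageSet π Φ, g', isCMType_preimageSet π hc hΦ, sumTwo_preimageSet π Φ g g' hg hs,
    noConjugatePair_preimageSet π hπ hc Φ g g' hg hnc, isSingleClass_preimageSet π Φ g',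
    isExceptional_preimageSet π hc hcc Φ g g' hg hinj hs hex, not_coset_preimageSet π g g' hg hcos⟩

/-- **Every Galois CM field with a cyclic CM subfield of degree `2rpq`** (`r ≥ 2`, `p ≠ q` odd primes) carries a
single-class `SumTwo` quadruple of CM types without a conjugate pair whose Pohlmann `4`-set is exceptional and a coset
of no subgroup: the finite model is a surjection `π : G →* ℤ/2rpq` with `π c = rpq`. -/
theorem exists_quad_of_surjective_cyclic {N r p q : ℕ} [NeZero N] (hN : N = 2 * (r * p * q)) (hr : 2 ≤ r)
    (hp : p.Prime) (hq : q.Prime) (hp2 : p ≠ 2) (hq2 : q ≠ 2) (hpq : p ≠ q)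
    (π : G →* Multiplicative (ZMod N)) (hπ : Function.Surjective π) {c : G} (hcc : IsComplexConj c)
    (hc : π c = Multiplicative.ofAdd ((r * p * q : ℕ) : ZMod N)) :
    ∃ (Φ' : Finset G) (g' : Fin 4 → G),
      IsCMType c Φ' ∧ SumTwo (fun i => rmul Φ' (g' i)) ∧
      (∀ i j : Fin 4, rmul Φ' (g' j) ≠ c • rmul Φ' (g' i)) ∧ IsSingleClass (fun i => rmul Φ' (g' i)) ∧
      IsExceptional c Φ' (twistSet g' 1) ∧
      ¬ ∃ (H : Subgroup G) (h : G), ∀ x, x ∈ twistSet g' 1 ↔ ∃ k ∈ H, x = k * h :=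
  exists_quad_of_surjective π hπ hc hcc (CyclicRecipe.Φ N r p q) (CyclicRecipe.gg N r p q)
    (CyclicRecipe.gg_injective hN hr hp hq hpq)
    (CyclicRecipe.isCMType_Φ hN (by omega) (hp.odd_of_ne_two hp2) (hq.odd_of_ne_two hq2))
    (CyclicRecipe.sumTwo_T hN hr hp.pos hq.pos) (CyclicRecipe.T_noConjugatePair hN hr hp hq hp2 hq2 hpq)
    (CyclicRecipe.Δ_isExceptional hN hr hp hq hp2 hq2 hpq) (CyclicRecipe.Δ_not_coset hN hr hp hq hp2 hq2)

end HodgeRepro.QuadPullback
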